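import Literature.Topology.FourManifolds.SurfaceGroupNielsenCoreSides
import Literature.Topology.FourManifolds.SurfaceGroupNielsenCoreSeparation2
import Literature.GroupTheory.CombinatorialGroupTheory.BinaryProductParity
import HarnessLib

/-!
# Nielsen's theorem, pillar CORE: a double point at the portals of two symbols — shared lemmas

Topic `Literature/Topology/FourManifolds`.  Auxiliary layer for the cases of the case analysis
of a double point `a < b` on the closed path of a potential-minimal configuration
(Zieschang–Vogt–Coldewey, LNM 835, proof of Thm. 5.3.2 with Lemma 5.3.4, in the
minimal-counterexample recasting of `SurfaceGroupNielsenCoreFrame.lean`) in which both cuts are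
PORTALS, `a` interior to the kernel of an occurrence `k` and `b` interior to the kernel of an
occurrence `k'` of a DIFFERENT symbol (`k' ≠ k`, `k' ≠ k̄`):

* `ppa_levels_match` — the per-level parity count of `BinaryProductParity.lean` applied to two
  families of crossing edges `E₁ e` (`e < A`) and `E₂ e` (`e < B`), one edge of each family at
  each level and no other crossing edge: a lone crossing edge at a level being impossible,
  `A = B`, and the two edges of level `e` lie on one component of the partner graph;
* `ppa_getElem?_of_sameComp_fpartner` — if the formal partners of two slots lie on one
  component with opposite types, the two slots carry inverse letters;
* `ppa_eq_invRev_of_getElem?` — a word whose letters are the inverses of the letters of another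
  word read backwards is its formal inverse;
* `Config.ppa_crossing_edge_cases` — for such a double point every crossing edge of the fixation
  is a formal edge of the symbol of `k` or of the symbol of `k'`, read at a slot of `k` resp.
  `k'` (no cut is a junction, so no cancelling edge crosses; formal edges of non-portal symbols
  do not cross by Claim (A));
* `Config.ppa_inside_of_between`, `Config.ppa_bar_between` — the occurrences strictly between
  `k` and `k'` are inside, and so are their partners (Claim (A)), which therefore also lie
  strictly between `k` and `k'`.

## References

* H. Zieschang, E. Vogt, H.-D. Coldewey, *Surfaces and Planar Discontinuous Groups*, LNM 835
  (1980), proof of Thm. 5.3.2 and Lemma 5.3.4. [ZieschangVogtColdewey1980]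
-/

noncomputable section

namespace Literature.Topology.FourManifolds

open Literature.GroupTheory.CombinatorialGroupTheory CycFactors List

namespace SurfaceGroup

/-! ## Two families of crossing edges, one of each at every level -/

/-- **Parity for two families of crossing edges.**  Let `E₁ e` (`e < A`) and `E₂ e` (`e < B`)
be crossing edges of the partner graph, `E₁ e` and `E₂ e` having an end of level `e`, such that
every crossing edge is one of them.  Then `A = B` (a level carrying exactly one crossing edge is
impossible) and for every `e < A` the ends of `E₁ e` and `E₂ e` lie on one component (two
crossing edges alone at their level share a component).
[cite: ZieschangVogtColdewey1980, proof of Lemma 5.3.4] -/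
theorem ppa_levels_match {ι : Type*} [DecidableEq ι] {U : List (List (ι × Bool))} {bar : ℕ → ℕ}
    {s : ℕ × ℕ → Bool} (h : CycNielsen U) (hU : U ≠ []) (hb : IsPairing U bar)
    (hP2 : ∀ κ, IsKernelSlot U κ → s κ = s (chainEnd U bar κ))
    {E₁ E₂ : ℕ → CycFactors.Edge} {A B : ℕ}
    (hE₁ : ∀ e, e < A → IsEdge U bar (E₁ e) ∧ IsCrossing s (E₁ e) ∧ ∃ ρ ∈ (E₁ e).2, level U ρ = e)
    (hE₂ : ∀ e, e < B → IsEdge U bar (E₂ e) ∧ IsCrossing s (E₂ e) ∧ ∃ ρ ∈ (E₂ e).2, level U ρ = e)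
    (hall : ∀ ε, IsEdge U bar ε → IsCrossing s ε →
      (∃ e, e < A ∧ ε = E₁ e) ∨ (∃ e, e < B ∧ ε = E₂ e)) :
    A = B ∧ ∀ e, e < A → ∀ ρ ∈ (E₁ e).2, ∀ ρ' ∈ (E₂ e).2, SameComp U bar ρ ρ' := by
  -- the crossing edges all of whose ends have level `e`
  have honly : ∀ e ε, IsEdge U bar ε → IsCrossing s ε → (∀ ρ ∈ ε.2, level U ρ = e) →
      (e < A ∧ ε = E₁ e) ∨ (e < B ∧ ε = E₂ e) := by
    intro e ε hε hc hl
    rcases hall ε hε hc with ⟨e', he', rfl⟩ | ⟨e', he', rfl⟩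
    · obtain ⟨ρ, hρ, hρl⟩ := (hE₁ e' he').2.2
      obtain rfl : e' = e := hρl.symm.trans (hl ρ hρ)
      exact Or.inl ⟨he', rfl⟩
    · obtain ⟨ρ, hρ, hρl⟩ := (hE₂ e' he').2.2
      obtain rfl : e' = e := hρl.symm.trans (hl ρ hρ)
      exact Or.inr ⟨he', rfl⟩
  have hAB : A = B := by
    by_contra hne
    rcases Nat.lt_or_gt_of_ne hne with hlt | hlt
    · obtain ⟨h1, h2, h3⟩ := hE₂ A hlt
      refine false_of_crossing_alone_level h hU hb hP2 h1 h2 h3 fun ε' hε' hc' hl' => ?_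
      rcases honly A ε' hε' hc' hl' with ⟨h4, -⟩ | ⟨-, h4⟩
      · exact absurd h4 (lt_irrefl A)
      · exact h4
    · obtain ⟨h1, h2, h3⟩ := hE₁ B hlt
      refine false_of_crossing_alone_level h hU hb hP2 h1 h2 h3 fun ε' hε' hc' hl' => ?_
      rcases honly B ε' hε' hc' hl' with ⟨-, h4⟩ | ⟨h4, -⟩
      · exact h4
      · exact absurd h4 (lt_irrefl B)
  refine ⟨hAB, fun e he => ?_⟩
  obtain ⟨h1, h2, h3⟩ := hE₁ e he
  refine sameComp_of_crossing_pair_level h hU hb hP2 h1 h2 h3 fun ε' hε' hc' hl' => ?_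
  rcases honly e ε' hε' hc' hl' with ⟨-, h4⟩ | ⟨-, h4⟩
  · exact Or.inl h4
  · exact Or.inr h4

/-! ## Letters -/

/-- **Paired crossing formal edges carry inverse letters at their far ends**: if the formal
partners of the slots `σ` and `τ` lie on one component of the partner graph with opposite
types, then the letter of `τ` is the inverse of the letter of `σ` (letters are constant on the
slots of one type of a component and inverse on the other type, and formal partners carry
inverse letters). [cite: ZieschangVogtColdewey1980, proof of Thm. 5.3.2] -/
theorem ppa_getElem?_of_sameComp_fpartner {ι : Type*} [DecidableEq ι] {U : List (List (ι × Bool))}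
    {bar : ℕ → ℕ} (h : CycNielsen U) (hU : U ≠ []) (hb : IsPairing U bar) {σ τ : ℕ × ℕ}
    (hσ : IsSlot U σ) (hτ : IsSlot U τ) (hs : SameComp U bar (fpartner U bar σ) (fpartner U bar τ))
    (ht : slotType U bar (fpartner U bar τ) ≠ slotType U bar (fpartner U bar σ)) :
    (fac U τ.1)[τ.2]? = ((fac U σ.1)[σ.2]?).map fun z => (z.1, !z.2) := by
  let _i : Inhabited ι := ⟨((fac U σ.1)[σ.2]'hσ.2).1⟩
  have key := hs.slotLetter_eq_of_slotType_ne h hU hb ht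
  rw [hb.slotLetter_fpartner hσ, hb.slotLetter_fpartner hτ] at key
  simp only [Bool.not_not, Prod.mk.injEq] at key
  obtain ⟨k1, k2⟩ := key
  rw [hσ.getElem?_eq, hτ.getElem?_eq, Option.map_some]
  congr 1
  exact Prod.ext k1 (by rw [← k2, Bool.not_not])

/-- **A word read backwards with inverted letters**: if `|A| = |B|` and the `i`-th letter of `A`
is the inverse of the `(|B| - 1 - i)`-th letter of `B` for every `i`, then `A = B⁻¹` formally.
[folklore] -/
theorem ppa_eq_invRev_of_getElem? {β : Type*} {A B : List (β × Bool)} (hlen : A.length = B.length)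
    (h : ∀ i, i < A.length → A[i]? = (B[B.length - 1 - i]?).map fun z => (z.1, !z.2)) :
    A = FreeGroup.invRev B := by
  refine List.ext_getElem? fun i => ?_
  rcases Nat.lt_or_ge i A.length with hi | hi
  · rw [h i hi, getElem?_invRev B (by omega)]
  · rw [List.getElem?_eq_none (by omega),
      List.getElem?_eq_none (by rw [FreeGroup.invRev_length]; omega)]

namespace Config

variable {g : ℕ} {φ : surfaceGen g → SurfaceGroup g}

section TwoPortals

variable (κ : Config φ) (hg : 1 ≤ g) (hI : Indecomposable φ) (hM : MarkedNontrivial φ) (hmin : κ.IsMin)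
include hg hI hM hmin

/-! ## The crossing edges of a double point at two portals -/

/-- **The crossing edges of the fixation of a double point at two portal cuts** (`a` interior to
the kernel of `k`, `b` interior to the kernel of `k'`, no occurrence a portal at both): every
crossing edge of the partner graph is the formal edge at a slot `(k, q)` or at a slot `(k', q)`
whose formal edge crosses — no cut is a junction, so no cancelling edge crosses, and the formal
edges of non-portal symbols do not cross (Claim (A)).
[cite: ZieschangVogtColdewey1980, proof of Thm. 5.3.2 and Lemma 5.3.4] -/
theorem ppa_crossing_edge_cases {a b : ℕ} (hab : a < b) (hbℓ : b < (closedPath κ.U).length)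
    (hsep : ∀ j, ¬ (κ.PortalAt a j ∧ κ.PortalAt b j))
    (hP2 : ∀ σ : ℕ × ℕ, IsKernelSlot κ.U σ → σ.1 < κ.w.length →
      ((a ≤ kpos κ.U σ ∧ kpos κ.U σ < b) ↔
        (a ≤ kpos κ.U (chainEnd κ.U κ.bar σ) ∧ kpos κ.U (chainEnd κ.U κ.bar σ) < b)))
    {k k' : ℕ} (hPa : κ.PortalAt a k) (hPb : κ.PortalAt b k') {ε : CycFactors.Edge}
    (hε : IsEdge κ.U κ.bar ε) (hc : IsCrossing (fun σ => decide (κ.SideIn a b σ)) ε) :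
    (∃ q, q < (fac κ.U k).length ∧ κ.FCross a b (k, q) ∧ ε = fedge κ.U κ.bar (k, q)) ∨
      (∃ q, q < (fac κ.U k').length ∧ κ.FCross a b (k', q) ∧ ε = fedge κ.U κ.bar (k', q)) := by
  have hbar := κ.isPairing_bar
  have hJa : ¬ κ.IsJunction a := κ.not_isJunction_of_portalAt hPa
  have hJb : ¬ κ.IsJunction b := κ.not_isJunction_of_portalAt hPb
  obtain ⟨σ, hσ, rfl | ⟨hkσ, rfl⟩⟩ := hε
  · have hfc : κ.FCross a b σ := (κ.fcross_iff_decide_ne _ _ _).2 (isCrossing_fedge.1 hc)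
    have hσ' : IsSlot κ.U (fpartner κ.U κ.bar σ) := hbar.isSlot_fpartner hσ
    have hfc' : κ.FCross a b (fpartner κ.U κ.bar σ) := (κ.fcross_fpartner_iff hσ).2 hfc
    have he' : fedge κ.U κ.bar σ = fedge κ.U κ.bar (fpartner κ.U κ.bar σ) :=
      (fedge_fpartner hbar hσ).symm
    obtain ⟨j, q⟩ := σ
    rcases κ.exists_portalAt_of_fcross hg hI hM hmin hP2 hσ hfc with h | h | h | h
    · have e1 : j = k := κ.portalAt_unique h hPa
      subst e1
      exact Or.inl ⟨q, hσ.2, hfc, rfl⟩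
    · have e1 : j = k' := κ.portalAt_unique h hPb
      subst e1
      exact Or.inr ⟨q, hσ.2, hfc, rfl⟩
    · have e1 : κ.bar j = k := κ.portalAt_unique h hPa
      refine Or.inl ⟨(fac κ.U j).length - 1 - q, ?_, ?_, ?_⟩
      · have h2 := hσ'.2
        simp only [fpartner, e1] at h2
        exact h2
      · simp only [fpartner, e1] at hfc'
        exact hfc'
      · rw [he']
        simp only [fpartner, e1]
    · have e1 : κ.bar j = k' := κ.portalAt_unique h hPb
      refine Or.inr ⟨(fac κ.U j).length - 1 - q, ?_, ?_, ?_⟩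
      · have h2 := hσ'.2
        simp only [fpartner, e1] at h2
        exact h2
      · simp only [fpartner, e1] at hfc'
        exact hfc'
      · rw [he']
        simp only [fpartner, e1]
  · exact absurd ((κ.ccross_iff_decide_ne hσ hkσ).2 (isCrossing_cedge.1 hc))
      (κ.not_ccross_of_not_isJunction hg hI hM hmin hab hbℓ hsep hJa hJb hσ)

/-! ## Occurrences between the two portal occurrences -/

omit hg hI hM hmin in
/-- An occurrence strictly between the portal occurrence `k` of `a` and the portal occurrence
`k'` of `b` is inside. [cite: ZieschangVogtColdewey1980, proof of Thm. 5.3.2] -/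
theorem ppa_inside_of_between {a b k k' : ℕ} (hPa : κ.PortalAt a k) (hPb : κ.PortalAt b k') {j : ℕ}
    (hkj : k < j) (hjk' : j < k') : κ.Inside a b j := by
  have h1 := κ.Kend_le_Kstart_of_lt hkj
  have h2 := κ.Kend_le_Kstart_of_lt hjk'
  have h3 := hPa.2
  have h4 := hPb.1
  exact ⟨by omega, by omega⟩

/-- **Claim (A) between two portals**: the partner of an occurrence `j` strictly between the
portal occurrence `k` of `a` and the portal occurrence `k'` of `b`, if it is neither `k` nor
`k'`, lies strictly between `k` and `k'` as well (both occurrences of the symbol are inside).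
[cite: ZieschangVogtColdewey1980, proof of Thm. 5.3.2 and Lemma 5.3.4] -/
theorem ppa_bar_between {a b : ℕ}
    (hP2 : ∀ σ : ℕ × ℕ, IsKernelSlot κ.U σ → σ.1 < κ.w.length →
      ((a ≤ kpos κ.U σ ∧ kpos κ.U σ < b) ↔
        (a ≤ kpos κ.U (chainEnd κ.U κ.bar σ) ∧ kpos κ.U (chainEnd κ.U κ.bar σ) < b)))
    {k k' : ℕ} (hPa : κ.PortalAt a k) (hPb : κ.PortalAt b k') {j : ℕ} (hj : j < κ.w.length)
    (hkj : k < j) (hjk' : j < k') (hj1 : κ.bar j ≠ k) (hj2 : κ.bar j ≠ k') :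
    k < κ.bar j ∧ κ.bar j < k' := by
  have hin : κ.Inside a b j := κ.ppa_inside_of_between hPa hPb hkj hjk'
  have hjk : j ≠ k := by omega
  have hjk'' : j ≠ k' := by omega
  have hna : ¬ κ.PortalAt a j := fun h => hjk (κ.portalAt_unique h hPa)
  have hnb : ¬ κ.PortalAt b j := fun h => hjk'' (κ.portalAt_unique h hPb)
  have hna' : ¬ κ.PortalAt a (κ.bar j) := fun h => hj1 (κ.portalAt_unique h hPa)
  have hnb' : ¬ κ.PortalAt b (κ.bar j) := fun h => hj2 (κ.portalAt_unique h hPb)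
  obtain ⟨h3, h4⟩ := (κ.inside_iff_inside_bar hg hI hM hmin hP2 hj hna hnb hna' hnb').1 hin
  have h5 := hPa.1
  have h6 := hPb.2
  constructor
  · exact (κ.Kstart_lt_Kstart_iff hg hI hM hmin).1 (by omega)
  · by_contra hle
    have := κ.Kend_le_Kend (not_lt.1 hle)
    omega

end TwoPortals

end Config

end SurfaceGroup

end Literature.Topology.FourManifolds

end
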